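import Summits.AtomisticToContinuum.Crystallization.Theorems.OverbindingBudgetCorefreeBridgeForceBalance

/-!
# `OverbindingBudget` / crux `RobustDefectLimitWindows` — HB1′: the corefree chart WITH the target's separation binder

Route `OverbindingBudget` (sub-problem `Crystallization`), crux `RobustDefectLimitWindows`
(item `stmt-AtomisticToContinuum-31280`), skeleton «HostedDustCut» (v7), door half B
`stub_corefreeRigidity`, helper-level sub-line `CorefreeRigidity` (lineage `decomp-a2c-lens-4`, g16).

REPAIR of the piece HB1 after the critic's refutation-as-typed (cell `decomp-a2c-crit-1`, CRITIC-LEDGER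
row 188, 2026-08-30): `CorefreeChart` (UD → COV → a ∈ [47/50, 1] → MAT → Corefree(1/10, 2/5) → Developable (1/5))
is FALSE AS TYPED — witness: the straight five-fold TWINNED COLUMN (decahedral wedge-disclination line: five fcc
tetrahedral wedges about a common atom row, fanned by k = 72°/70.53°, axis atoms dimerised).  Its axis atoms are
corefree at `(1/10, 2/5)` THROUGH THE HCP PATTERN (their bicapped eclipsed pentagonal-prism shell is `(2/5)`-close
to the hcp kissing pattern, bottleneck 0.3684 < 2/5), `MAT` only constrains GT-clean sites (the axis atoms are
GT-violators), and the column is not developable from any Hägg stacking (no spanning 4-regular 24-edge subgraph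
of the bicapped-prism contact graph).  CLASS misstated-by-omission: the sub-line dropped the target's
separation binder `SEP` from the GS-free chart; in the v7 target the column is excluded by `SEP ∧ MAT` jointly
(the violator axis atoms form a LINE, which no `D ∈ [0, 13]` `(D, 2D+6)`-separates).

This file types the critic's repair **HB1′** = `CorefreeChartSep` := `CorefreeChart` with the target's
`∀ D, 0 ≤ D → D ≤ 13 → SEP a D Y →` re-inserted before `MAT` (every binder already typed in
`Theorems.OverbindingBudgetCorefreeBridge`), records `CorefreeChart → CorefreeChartSep`, and RE-GLUES door
half B from HB1′ (the target supplies `SEP` and `D`; the force balance is the proved `muGSCForceBalance`):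
`stub_corefreeRigidity_of_pieces_sep : CorefreeChartSep → LargeScaleRegularity → StackingSelection →
HcpLiouville → PhononStability → ‹registered text of stub_corefreeRigidity›`.
-/

noncomputable section

namespace Summit.AtomisticToContinuum.Crystallization.Theorems.OverbindingBudgetCorefreeBridge

open Literature.MathematicalPhysics.StatisticalMechanics (UniformlyDiscrete lennardJones IsMuGSC)
open Summit.AtomisticToContinuum.Crystallization.Theorems.OverbindingBudgetWallTensionLever (MAT)
open Summit.AtomisticToContinuum.Crystallization.Theorems.OverbindingBudgetViolatorDensityFloor (GT)

/-- **HB1′ — the corefree chart under separation** (GS-free, geometric; the critic's repair of HB1, row 188):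
a uniformly discrete `Y` with covering radius `< 9/10`, scale `a ∈ [47/50, 1]`, whose GT-violators are
`(D, 2D+6)`-separated for some `D ∈ [0, 13]` (`SEP`), whose GT-clean sites are `(1/5)`-Barlow matched (`MAT`)
and all of whose sites are coarse-clean and coarse-matched at `(1/10, 2/5)` (`Corefree`), is developable on one
reference close-packed stacking with touching-pair distortion `1/5`.  `SEP` confines the violators to ONE
compact clump of diameter `≤ D` (or none), which carries no holonomy. -/
def CorefreeChartSep : Prop :=
  ∀ Y : Set E3, UniformlyDiscrete Y → COV Y → ∀ a : ℝ, 47 / 50 ≤ a → a ≤ 1 →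
    ∀ D : ℝ, 0 ≤ D → D ≤ 13 → SEP a D Y → MAT a Y → Corefree a Y → Developable (1 / 5) a Y

/-- HB1′ is weaker than (implied by) the refuted-as-typed HB1. [folklore] -/
theorem corefreeChartSep_of_corefreeChart (h : CorefreeChart) : CorefreeChartSep :=
  fun Y hUD hcov a ha1 ha2 _D _hD0 _hD13 _hsep hMAT hcore => h Y hUD hcov a ha1 ha2 hMAT hcore

/-- **Door half B from HB1′ + B-large + B-stack + 9332 + 9333** (force balance proved): the composition of
`corefreeRigidity_of_pieces` re-glued with the separation binder threaded into the chart. -/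
theorem corefreeRigidity_of_pieces_sep (hC : CorefreeChartSep) (hL : LargeScaleRegularity)
    (hS : StackingSelection)
    (h9332 : Summit.AtomisticToContinuum.Crystallization.Theses.ExcessDecayLiouville.HcpLiouville)
    (h9333 : Summit.AtomisticToContinuum.Crystallization.Theses.ExcessDecayLiouville.PhononStability) :
    ∀ e : ℝ, TEND e → LB e → ∀ Y : Set E3, UniformlyDiscrete Y → IsMuGSC lennardJones e Y → COV Y →
      ∀ a : ℝ, 47 / 50 ≤ a → a ≤ 1 → ∀ D : ℝ, 0 ≤ D → D ≤ 13 → SEP a D Y → MAT a Y → Corefree a Y →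
        ∀ y ∈ Y, GT a Y y := by
  intro e hT hLB Y hUD hμ hcov a ha1 ha2 D hD0 hD13 hsep hMAT hcore y hy
  have hchart : Developable (1 / 5) a Y := hC Y hUD hcov a ha1 ha2 D hD0 hD13 hsep hMAT hcore
  have hGB : GlobalBarlowMatch (1 / 40) Y := hL e hT hLB Y hUD hμ hcov a ha1 ha2 hMAT hcore hchart
  obtain ⟨t, A, hA, hI, hNear⟩ := hS e hT hLB Y hUD hμ hGB
  have hEq : Equil Y := muGSCForceBalance e Y hUD hμ
  obtain ⟨q, hq, hclean⟩ := exists_clean_of_sep_cov hD0 hcov hsep hy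
  obtain ⟨δ, hδ, hsepδ⟩ := hUD
  obtain ⟨t', A', _hA', hYeq⟩ := h9332 h9333 δ hδ Y hsepδ hEq t A hA hI hNear
  have hYS : Y = Sites t' A' := hYeq
  subst hYS
  exact sites_homogeneous hq hy hclean

/-- The same against the REGISTERED text of `stub_corefreeRigidity` (skeleton «HostedDustCut» v7 on
stmt-AtomisticToContinuum-31280, byte-identical): HB1′, B-large, B-stack and the two `ExcessDecayLiouville`
items imply door half B. -/
theorem stub_corefreeRigidity_of_pieces_sep (hC : CorefreeChartSep) (hL : LargeScaleRegularity)
    (hS : StackingSelection)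
    (h9332 : Summit.AtomisticToContinuum.Crystallization.Theses.ExcessDecayLiouville.HcpLiouville)
    (h9333 : Summit.AtomisticToContinuum.Crystallization.Theses.ExcessDecayLiouville.PhononStability) :
    ∀ e : ℝ, Filter.Tendsto (fun N : ℕ => Literature.MathematicalPhysics.StatisticalMechanics.groundStateEnergy Literature.MathematicalPhysics.StatisticalMechanics.lennardJones 3 N / N) Filter.atTop (nhds e) → (∀ N : ℕ, 0 < N → e ≤ Literature.MathematicalPhysics.StatisticalMechanics.groundStateEnergy Literature.MathematicalPhysics.StatisticalMechanics.lennardJones 3 N / N) → ∀ Y : Set (EuclideanSpace ℝ (Fin 3)), Literature.MathematicalPhysics.StatisticalMechanics.UniformlyDiscrete Y → Literature.MathematicalPhysics.StatisticalMechanics.IsMuGSC Literature.MathematicalPhysics.StatisticalMechanics.lennardJones e Y → (∀ z : EuclideanSpace ℝ (Fin 3), ∃ w ∈ Y, dist z w < 9 / 10) → ∀ a : ℝ, 47 / 50 ≤ a → a ≤ 1 → ∀ D : ℝ, 0 ≤ D → D ≤ 13 → (∀ p ∈ Y, ∀ q ∈ Y, ¬ ({w ∈ Y | w ≠ p ∧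 dist p w ≤ a * (1 + 1 / 50)}.ncard = 12 ∧ ∀ w ∈ Y, w ≠ p → a * (1 - 1 / 50) ≤ dist p w ∧ (dist p w ≤ a * (1 + 1 / 50) ∨ a * (63 / 50) ≤ dist p w)) → ¬ ({w ∈ Y | w ≠ q ∧ dist q w ≤ a * (1 + 1 / 50)}.ncard = 12 ∧ ∀ w ∈ Y, w ≠ q → a * (1 - 1 / 50) ≤ dist q w ∧ (dist q w ≤ a * (1 + 1 / 50) ∨ a * (63 / 50) ≤ dist q w)) → (dist p q ≤ D ∨ 2 * D + 6 ≤ dist p q)) → (∀ y ∈ Y, ({w ∈ Y | w ≠ y ∧ dist y w ≤ a * (1 + 1 / 50)}.ncard = 12 ∧ ∀ w ∈ Y, w ≠ y → a * (1 - 1 / 50) ≤ dist y w ∧ (dist y w ≤ a * (1 + 1 / 50) ∨ a * (63 / 50) ≤ dist y w)) → (∃ T : Finset (EuclideanSpace ℝ (Fin 3)), (↑T : Set (EuclideanSpace ℝ (Fin 3))) = (fun w => a⁻¹ • (w - y)) '' {w ∈ Y | w ≠ y ∧ dist y w ≤ a * (1 + 1 / 50)} ∧ (Literature.Geometry.DiscreteGeometry.ShellCloseTo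 (1 / 5) T Literature.Geometry.DiscreteGeometry.fccKissingPattern ∨ Literature.Geometry.DiscreteGeometry.ShellCloseTo (1 / 5) T Literature.Geometry.DiscreteGeometry.hcpKissingPattern))) → (∀ y ∈ Y, ¬ ¬ (({v ∈ Y | v ≠ y ∧ dist y v ≤ a * (1 + 1 / 10)}.ncard = 12 ∧ ∀ v ∈ Y, v ≠ y → a * (1 - 1 / 10) ≤ dist y v ∧ (dist y v ≤ a * (1 + 1 / 10) ∨ a * (63 / 50) ≤ dist y v)) ∧ (∃ T : Finset (EuclideanSpace ℝ (Fin 3)), (↑T : Set (EuclideanSpace ℝ (Fin 3))) = (fun v => a⁻¹ • (v - y)) '' {v ∈ Y | v ≠ y ∧ dist y v ≤ a * (1 + 1 / 10)} ∧ (Literature.Geometry.DiscreteGeometry.ShellCloseTo (2 / 5) T Literature.Geometry.DiscreteGeometry.fccKissingPattern ∨ Literature.Geometry.DiscreteGeometry.ShellCloseTo (2 / 5) T Literature.Geometry.DiscreteGeometry.hcpKissingPattern)))) → ∀ y ∈ Y, ({w ∈ Y | w ≠ y ∧ dist y w ≤ a * (1 + 1 / 50)}.ncard = 12 ∧ ∀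 w ∈ Y, w ≠ y → a * (1 - 1 / 50) ≤ dist y w ∧ (dist y w ≤ a * (1 + 1 / 50) ∨ a * (63 / 50) ≤ dist y w)) := by
  intro e hT hLB Y hUD hμ hcov a ha1 ha2 D hD0 hD13 hsep hMAT hcore
  exact corefreeRigidity_of_pieces_sep hC hL hS h9332 h9333 e hT hLB Y hUD hμ hcov a ha1 ha2 D hD0 hD13 hsep
    hMAT hcore

end Summit.AtomisticToContinuum.Crystallization.Theorems.OverbindingBudgetCorefreeBridge

end
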